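import Literature.IUT.LogVolume.TensorPacketMShellUnramified
import Literature.IUT.LogVolume.DifferentEstimatesCorollaries
import Literature.IUT.LogVolume.LogUnitsSubmodule
import HarnessLib

/-!
# Mochizuki's container EQUALS Dupuy–Hilado's log-shell at TAME tuples: the two named shell normalisations
# of the cell (`realPrimePacketM` / `realPrimePacket`) agree wherever `p > 2` and every `e_i ≤ p − 2`
# ([IUTchIV] Prop. 1.2 (i)/(ii), proof of Prop. 1.4 (iii))

Record-only file (D-0012) of the abc-iut cell (Cor. 3.12 sub-crew, seat abc-iut-c312-3; planner ruling R6-a "BOTH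
normalisations stay typed and named"); TAKES NO SIDE. Mochizuki, *Inter-universal Teichmüller theory IV* (RIMS ms
Apr. 2020 = PRIMS **57** (2021)), Prop. 1.2, kurims p. 10: "`a_i := (1/e_i)·⌈e_i/(p−2)⌉` … Thus, if `p > 2` and
`e_i ≤ p − 2`, then `a_i = 1/e_i = −b_i`", (ii) "In particular, `φ((R_I)^∼) ⊆ p^{−⌈d_I+a_I⌉}·log_p(R_I^×)`";
proof of Prop. 1.4 (iii), p. 14: "`d_i ≥ (e_i − 1)/e_i` … [cf. Proposition 1.3, (i)]" — with EQUALITY `d_i =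
(e_i − 1)/e_i` in the tame case `p ∤ e_i` (Serre, *Corps locaux* III §6 Prop. 13; the tree's
`differentOrd_eq_of_not_dvd`, abc-iut-S1). Dupuy–Hilado, arXiv:2004.13228 (pre-split text) §4 intro:
"`I_{v̲} = (1/2p_{v̲}) log(O^×_{v̲})`" (the cell's `logShell = (2p)^{−|I|}·log_p(R_I^×)`).

CONTEXT. The cell keeps two shells for the real prime packet: Dupuy–Hilado's `I_{v⃗}` (`realPrimePacket`) and
Mochizuki's container `mShell = p^{−⌈d_I+a_I⌉}·log_p(R_I^×)` (`realPrimePacketM`, `TensorPacketModelScaled.lean`).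
The question R7-C3-Q1 (does the Dupuy–Hilado-normalised (Ind3)-datum exist from the ideles alone?) was answered
NO at WILDLY ramified tuples by exact computation (seat abc-iut-c312-d1, HOME/plan/c312/R7C3Q1-COMPUTATION.md).
THIS FILE proves the complementary POSITIVE statement in the kernel: at a TAME tuple — `p > 2` and every
`e_i ≤ p − 2` — one has `d_i + a_i = (e_i−1)/e_i + 1/e_i = 1`, so `⌈d_I + a_I⌉ = |I|` and
`mShell = p^{−|I|}·log_p(R_I^×) = (2p)^{−|I|}·log_p(R_I^×) = logShell` (`2` is a `p`-adic unit and `log_p(R_I^×)` is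
a `ℤ_p`-module, abc-iut-S1's `smul_mem_logUnits`); likewise at `p = 2` with every `e_i = 1` (`a_i = 2`,
`d_i = 0`). Consequently `(R_I)^∼ ⊆ I_{v⃗}` there (Prop. 1.2 (ii) with `φ = id`, via `normalizedPacket_subset_mShell`),
i.e. the two normalisations DIFFER ONLY AT WILD TUPLES, and the SHARP Dupuy–Hilado datum `O_𝕃(−P_Θ)` satisfies
the (4.10)-shaped bound at every tame tuple (summit side: `LDHTensorTame.lean`).
* `smul_coe_logPacket_subset_of_norm_le_one` — `ℤ_p`-scalars on `log_p(R_I^×)` (unit scalars then fix it);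
* `differentOrd_add_logRadiusA_eq_one_of_tame`, `mShellExp_eq_card_of_tame`, `mShell_eq_logShell_of_tame`,
  `normalizedPacket_subset_logShell_of_tame`, `smul_normalizedPacket_subset_iUnion_logShell_of_tame`;
* `mShellExp_eq_two_mul_card_of_two`, `mShell_eq_logShell_of_two` (the prime `2`, unramified factors);
* real packets: `realPrimePacketM_shell_eq_shell_of_tame`, `realPrimePacket_peel_O_subset_iUnion_shell_of_tame`.
[cite: Mochizuki2012, IUTchIV Prop. 1.2 (i)(ii) p. 10, Prop. 1.4 (iii) proof p. 14] [cite: SerreLocalFields1979,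
Ch. III §6 Prop. 13] [cite: DupuyHilado2025, §4 (intro), §4.10] [claim: Mochizuki2012, status: disputed]
Theorems only; nothing here says which normalisation [IUTchIII] Thm. 3.11 (ii) (Ind3) means; no side on Cor. 3.12.
-/

noncomputable section

open Set
open scoped Pointwise

namespace Literature.IUT.LogVolume

/-! ## `ℤ_p`-scalars on `log_p(R_I^×)` -/

section Packet

variable (p : ℕ) [Fact p.Prime]
variable {I : Type} [Fintype I] [DecidableEq I]
variable (k : I → Type) [∀ i, NontriviallyNormedField (k i)] [∀ i, NormedAlgebra ℚ_[p] (k i)]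
  [∀ i, IsUltrametricDist (k i)] [∀ i, ProperSpace (k i)]

omit [Fintype I] in
/-- `ℤ_p`-scalars preserve `log_p(R_I^×) = ⊗_{ℤ_p} log_p(R_i^×)`: for `‖r‖ ≤ 1`, `r·log_p(R_I^×) ⊆ log_p(R_I^×)` (push
`r` into one slot; each `log_p(R_i^×)` is a `ℤ_p`-module). [cite: Mochizuki2012, IUTchIV Prop. 1.2 p. 10] -/
theorem smul_coe_logPacket_subset_of_norm_le_one [Nonempty I] {r : ℚ_[p]} (hr : ‖r‖ ≤ 1) :
    r • (logPacket p k : Set (PacketAlgebra p k)) ⊆ logPacket p k := by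
  obtain ⟨i₀⟩ := ‹Nonempty I›
  rintro _ ⟨x, hx, rfl⟩
  change r • x ∈ (logPacket p k : Set (PacketAlgebra p k))
  refine AddSubgroup.closure_induction (fun t ht => ?_) ?_ (fun a b _ _ ha hb => ?_) (fun a _ ha => ?_) hx
  · obtain ⟨z, hz, rfl⟩ := ht
    have h := (PiTensorProduct.tprod ℚ_[p]).map_update_smul z i₀ r (z i₀)
    rw [Function.update_eq_self] at h
    change r • PiTensorProduct.tprod ℚ_[p] z ∈ (logPacket p k : Set (PacketAlgebra p k))
    rw [← h]
    refine AddSubgroup.subset_closure ⟨Function.update z i₀ (r • z i₀), fun i => ?_, rfl⟩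
    by_cases hi : i = i₀
    · subst hi
      rw [Function.update_self]
      have h2 := smul_mem_logUnits p (k i) ⟨r, hr⟩ (hz i)
      rw [Algebra.smul_def] at h2
      have h3 : r • z i = algebraMap ℤ_[p] (k i) ⟨r, hr⟩ * z i := by
        rw [Algebra.smul_def]
        rfl
      rwa [← h3] at h2
    · rw [Function.update_of_ne hi]
      exact hz i
  · rw [smul_zero]
    exact (logPacket p k).zero_mem
  · rw [smul_add]
    exact (logPacket p k).add_mem ha hb
  · rw [smul_neg]
    exact (logPacket p k).neg_mem ha

/-- `‖2‖_p = 1` for an odd prime `p`. [cite: Mochizuki2012, IUTchIV Prop. 1.2 p. 10] -/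
private theorem norm_two_eq_one (hp : 2 < p) : ‖(2 : ℚ_[p])‖ = 1 := by
  have h1 : ‖((2 : ℤ) : ℚ_[p])‖ ≤ 1 := Padic.norm_int_le_one 2
  have h2 : ¬ ‖((2 : ℤ) : ℚ_[p])‖ < 1 := by
    rw [Padic.norm_intCast_lt_one_iff]
    intro h
    have : (p : ℤ) ≤ 2 := Int.le_of_dvd (by norm_num) h
    omega
  push_cast at h1 h2
  exact le_antisymm h1 (not_lt.mp h2)

/-! ## Tame tuples: `d_i + a_i = 1`, `⌈d_I + a_I⌉ = |I|`, `mShell = logShell` -/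

section OneFactor

variable {K : Type} [NontriviallyNormedField K] [NormedAlgebra ℚ_[p] K] [IsUltrametricDist K] [ProperSpace K]

/-- **`d + a = 1` at a tame factor**: for `p > 2` and `e ≤ p − 2`, `d = (e−1)/e` (Serre III §6 Prop. 13, tame
case `p ∤ e`) and `a = 1/e`. [cite: Mochizuki2012, IUTchIV Prop. 1.2 p. 10, Prop. 1.4 (iii) proof p. 14] -/
theorem differentOrd_add_logRadiusA_eq_one_of_tame (hp : 2 < p) (he : absRamificationIdx p K ≤ p - 2) :
    differentOrd p K + logRadiusA p (absRamificationIdx p K) = 1 := by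
  have he1 := absRamificationIdx_pos p K
  have hnd : ¬ p ∣ absRamificationIdx p K := fun h => by
    have := Nat.le_of_dvd he1 h
    omega
  have he0 : (absRamificationIdx p K : ℝ) ≠ 0 := by exact_mod_cast he1.ne'
  rw [differentOrd_eq_of_not_dvd p K hnd, logRadiusA_eq hp he1 he]
  field_simp
  ring

end OneFactor

omit [DecidableEq I] in
/-- **`⌈d_I + a_I⌉ = |I|` at a tame tuple** (`p > 2`, every `e_i ≤ p − 2`): `d_I + a_I = Σ_i (d_i + a_i) = |I|`.
[cite: Mochizuki2012, IUTchIV Prop. 1.2 (ii) p. 10] -/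
theorem mShellExp_eq_card_of_tame (hp : 2 < p) (he : ∀ i, absRamificationIdx p (k i) ≤ p - 2) :
    mShellExp p k = Fintype.card I := by
  have h : dSum p k + aSum p k = Fintype.card I := by
    rw [dSum, aSum, ← Finset.sum_add_distrib,
      Finset.sum_congr rfl fun i _ => differentOrd_add_logRadiusA_eq_one_of_tame p hp (he i)]
    simp
  rw [mShellExp, h]
  exact Int.ceil_natCast _

/-- **Mochizuki's container IS Dupuy–Hilado's log-shell at a tame tuple**: for `p > 2` and every `e_i ≤ p − 2`,
`p^{−⌈d_I+a_I⌉}·log_p(R_I^×) = p^{−|I|}·log_p(R_I^×) = (2p)^{−|I|}·log_p(R_I^×)` (`2^{−|I|} ∈ ℤ_p^×`).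
[cite: Mochizuki2012, IUTchIV Prop. 1.2 (ii) p. 10] -/
theorem mShell_eq_logShell_of_tame [Nonempty I] (hp : 2 < p) (he : ∀ i, absRamificationIdx p (k i) ≤ p - 2) :
    mShell p k = logShell p k := by
  have hscal : ((2 * p : ℚ_[p]) ^ Fintype.card I)⁻¹ =
      ((p : ℚ_[p]) ^ Fintype.card I)⁻¹ * ((2 : ℚ_[p]) ^ Fintype.card I)⁻¹ := by
    rw [mul_pow, mul_inv, mul_comm]
  -- the unit `2^{−|I|} ∈ ℤ_p^×` fixes `log_p(R_I^×)`
  set u : ℚ_[p] := ((2 : ℚ_[p]) ^ Fintype.card I)⁻¹ with hu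
  have h2 : ‖u‖ = 1 := by
    rw [hu, norm_inv, norm_pow, norm_two_eq_one p hp, one_pow, inv_one]
  have hu0 : u ≠ 0 := norm_pos_iff.mp (by rw [h2]; exact one_pos)
  have hfix : u • (logPacket p k : Set (PacketAlgebra p k)) = logPacket p k := by
    refine le_antisymm (smul_coe_logPacket_subset_of_norm_le_one p k h2.le) fun x hx => ?_
    refine ⟨u⁻¹ • x, smul_coe_logPacket_subset_of_norm_le_one p k (by rw [norm_inv, h2, inv_one])
      (Set.smul_mem_smul_set hx), ?_⟩
    change u • (u⁻¹ • x) = x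
    rw [smul_smul, mul_inv_cancel₀ hu0, one_smul]
  rw [logShell, shellScalar, hscal, ← smul_smul, hfix, mShell_eq_const_smul,
    mShellExp_eq_card_of_tame p k hp he, zpow_neg, zpow_natCast]

/-- Hence **`(R_I)^∼ ⊆ I_{v⃗}` at a tame tuple** (`|I| ≥ 2`): Prop. 1.2 (ii) with `φ = id` in Dupuy–Hilado's
normalisation — what fails at wildly ramified tuples (R7-C3-Q1) holds at tame ones.
[cite: Mochizuki2012, IUTchIV Prop. 1.2 (ii) p. 10] -/
theorem normalizedPacket_subset_logShell_of_tame (hI : 2 ≤ Fintype.card I) (hp : 2 < p)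
    (he : ∀ i, absRamificationIdx p (k i) ≤ p - 2) :
    (normalizedPacket p k : Set (PacketAlgebra p k)) ⊆ logShell p k := by
  haveI : Nonempty I := Fintype.card_pos_iff.mp (by omega)
  rw [← mShell_eq_logShell_of_tame p k hp he]
  exact normalizedPacket_subset_mShell p k hI

/-- … and every translate `g·(R_I)^∼` lies in `⋃_n g^n·I_{v⃗}` (the `n = 1` term): the (4.10)-SHAPED bound for
the MINIMAL region holds in Dupuy–Hilado's own normalisation at a tame tuple. [cite: DupuyHilado2025, §4.10] -/
theorem smul_normalizedPacket_subset_iUnion_logShell_of_tame (hI : 2 ≤ Fintype.card I) (hp : 2 < p)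
    (he : ∀ i, absRamificationIdx p (k i) ≤ p - 2) (g : PacketAlgebra p k) :
    g • (normalizedPacket p k : Set (PacketAlgebra p k)) ⊆ ⋃ n : ℕ, (fun x => g * x)^[n] '' logShell p k := by
  haveI : Nonempty I := Fintype.card_pos_iff.mp (by omega)
  rw [← mShell_eq_logShell_of_tame p k hp he]
  exact smul_normalizedPacket_subset_iUnion_mShell p k hI g

/-! ## The prime `2` with unramified factors: `a_i = 2`, `d_i = 0`, `mShell = 2^{−2|I|}·log_2(R_I^×) = logShell` -/

omit [DecidableEq I] in
/-- At `p = 2` with every `e_i = 1`: `⌈d_I + a_I⌉ = 2|I|` (`a_i = 2`, `d_i = 0`).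
[cite: Mochizuki2012, IUTchIV Prop. 1.2 p. 10] -/
theorem mShellExp_eq_two_mul_card_of_two (hp : p = 2) (he : ∀ i, absRamificationIdx p (k i) = 1) :
    mShellExp p k = 2 * Fintype.card I := by
  have h : aSum p k = 2 * Fintype.card I := by
    rw [aSum]
    simp only [logRadiusA, if_pos hp, Finset.sum_const, Finset.card_univ, nsmul_eq_mul]
    ring
  rw [mShellExp, dSum_eq_zero_of_unramified p k he, zero_add, h]
  have : ((2 : ℝ) * Fintype.card I) = ((2 * Fintype.card I : ℕ) : ℝ) := by push_cast; ring
  rw [this, Int.ceil_natCast]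
  push_cast
  ring

omit [DecidableEq I] in
/-- At `p = 2` with every `e_i = 1`: `mShell = 2^{−2|I|}·log_2(R_I^×) = (2·2)^{−|I|}·log_2(R_I^×) = logShell`.
[cite: Mochizuki2012, IUTchIV Prop. 1.2 (ii) p. 10] -/
theorem mShell_eq_logShell_of_two (hp : p = 2) (he : ∀ i, absRamificationIdx p (k i) = 1) :
    mShell p k = logShell p k := by
  rw [mShell_eq_const_smul, mShellExp_eq_two_mul_card_of_two p k hp he, logShell, shellScalar]
  congr 1
  have h2 : (2 : ℚ_[p]) = (p : ℚ_[p]) := by subst hp; norm_num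
  rw [h2, ← sq, ← pow_mul, show (-(2 * (Fintype.card I : ℤ))) = -((2 * Fintype.card I : ℕ) : ℤ) by push_cast; ring,
    zpow_neg, zpow_natCast]

end Packet

/-! ## The real prime packets at a tame prime -/

section Real

variable {F : Type} [Field F] [NumberField F]
variable (p : ℕ) [Fact p.Prime] (𝔽 : LocalFields F p)

/-- **The two named shells of the cell coincide at a tame prime**: if `p > 2` and every `K_{v̲_a}` (`a ≤ j`) has
`e ≤ p − 2`, then `realPrimePacketM` and `realPrimePacket` have the SAME shell at `v⃗`.
[cite: Mochizuki2012, IUTchIV Prop. 1.2 (ii) p. 10] [cite: DupuyHilado2025, §4 (intro)] -/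
theorem realPrimePacketM_shell_eq_shell_of_tame (hp : 2 < p) {j : ℕ} (e : Fin (j + 1) → placesOver F p)
    (he : ∀ a, absRamificationIdx p (𝔽.k (e a)) ≤ p - 2) :
    (realPrimePacketM p 𝔽).shell j e = (realPrimePacket p 𝔽).shell j e := by
  rw [realPrimePacketM_shell, realPrimePacket_shell]
  exact mShell_eq_logShell_of_tame p (fun a => 𝔽.k (e a)) hp he

/-- **In Dupuy–Hilado's own normalisation the (4.10)-shaped bound holds for the MINIMAL theta region at a tame
prime**: for `p > 2`, every `K_{v̲_a}` with `e ≤ p − 2`, every degree `j = i+1 ≥ 1` and every scalar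
`a ∈ K_{v̲_j}^×`, `ι_j(a)·(R_I)^∼ ⊆ ⋃_n (ι_j(a)·−)^n(I_{v⃗})` (the `n = 1` term).
[cite: DupuyHilado2025, §4.10] [cite: Mochizuki2012, IUTchIV Prop. 1.2 (ii) p. 10] -/
theorem realPrimePacket_peel_O_subset_iUnion_shell_of_tame (hp : 2 < p) (i : ℕ)
    (e : Fin (i + 1 + 1) → placesOver F p) (he : ∀ a, absRamificationIdx p (𝔽.k (e a)) ≤ p - 2)
    (a : (𝔽.k (e (Fin.last (i + 1))))ˣ) :
    (realPrimePacket p 𝔽).peel a '' (realPrimePacket p 𝔽).O (i + 1) e ⊆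
      ⋃ n : ℕ, ((realPrimePacket p 𝔽).peel a)^[n] '' (realPrimePacket p 𝔽).shell (i + 1) e := by
  rw [realPrimePacket_shell, realPrimePacket_peel_image, realPrimePacket_O]
  have hI : 2 ≤ Fintype.card (Fin (i + 1 + 1)) := by simp
  exact smul_normalizedPacket_subset_iUnion_logShell_of_tame p (fun a' => 𝔽.k (e a')) hI hp he
    (iota p (fun a' => 𝔽.k (e a')) (Fin.last (i + 1)) (a : 𝔽.k (e (Fin.last (i + 1)))))

end Real

end Literature.IUT.LogVolume

end
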